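import Summits.ResolutionOfSingularities.ResolutionOfSingularities.Theses.PAlteration
import Summits.ResolutionOfSingularities.ResolutionOfSingularities.Theorems.PAlterationAssemblyPerfect
import Summits.ResolutionOfSingularities.ResolutionOfSingularities.Theorems.PAlterationAssemblyLevels
import Summits.ResolutionOfSingularities.ResolutionOfSingularities.Theorems.PAlterationPicoverToRadicialBottomFrobenius
import Literature.AlgebraicGeometry.Resolution.RegularDerivationQuotient
import Literature.AlgebraicGeometry.Resolution.RegularTensorTower
import Literature.AlgebraicGeometry.Resolution.PIndependence
import Literature.AlgebraicGeometry.Resolution.ProjectiveSpaceRegular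
import Literature.AlgebraicGeometry.Resolution.ResolutionGlue
import Literature.FieldTheory.Separability.PIndependentDerivations
import Literature.AlgebraicGeometry.Resolution.PrincipalizationToResolution

/-!
# Line `theta-finite-cofinite-roots` for the crux `PicoverToRadicialBottom`
(stmt-ResolutionOfSingularities-0556) — lead's skeleton (v1, reshaped)

`PicoverToRadicialBottom_of : PicoverToRadicialBottom` (by name) from registered stubs.
Composition (v1 replaces `stub_lineAssembly` by the real proof, Theorem-A style):
X integral separated f.t./k, g : X'' → X finite UI surjective, π : Z → X'' a resolution,
ρ := π ≫ g. (T1) over a non-empty affine W ⊆ X the p^N-Frobenius of Γ(ρ⁻¹W) factors through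
Γ(W) (shrinking, no normality); (T6 = T3+T3'+T4+T5+glue) a field L ⊇ k inside k^{1/p^N} with
ψ : L → k (x ↦ x^{p^N}) FINITE and Z_L := Z ×_k Spec L REGULAR; (T2) the twisted relative
Frobenius Ψ : X → X_L, finite UI surjective with Ψ ≫ pr = F_X^N; T := (X ×_{Ψ,X_L} Z_L)_red is
integral, finite radicial surjective over the regular Z_L (f.t. over the field L) — PICover_p over
L resolves T — and T → X is proper and birational (section over W), so X has a resolution.
-/

noncomputable section

-- single-problem summit: the doubled namespace component `ResolutionOfSingularities` is forced
set_option linter.dupNamespace false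

open CategoryTheory CategoryTheory.Limits AlgebraicGeometry TopologicalSpace Topology
open scoped TensorProduct
open Literature.AlgebraicGeometry.Resolution Literature.AlgebraicGeometry.Motives
open Scheme.IdealSheafData
open Summit.ResolutionOfSingularities.ResolutionOfSingularities.Theses.PAlteration

namespace Summit.ResolutionOfSingularities.ResolutionOfSingularities.Theorems

/-! ## Stubs -/

/-- (T1) **Generic Frobenius factor of a finite radicial cover, after shrinking.** For
`ρ : Z → X` surjective between integral schemes of characteristic `p`, finite and universally
injective over a non-empty open `U`, there is a non-empty affine open `W ≤ U` and `N` such that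
the `p^N`-th power map of `Γ(ρ⁻¹ W)` factors through `Γ(W)` (no normality: clear the
denominators of `exists_mul_pow_eq_of_universallyInjective` on module generators and pass to a
basic open). [folklore] -/
theorem stub_frobeniusFactorGeneric :
    ∀ (p : ℕ) [Fact p.Prime] (Z X : Scheme.{0}) [IsIntegral Z] [IsIntegral X] (ρ : Z ⟶ X)
      [Surjective ρ] (U : X.Opens) [Nonempty ↥U] [IsFinite (ρ ∣_ U)]
      [UniversallyInjective (ρ ∣_ U)], (p : Γ(X, ⊤)) = 0 →
      ∃ (W : X.Opens) (_ : IsAffineOpen W) (_ : Nonempty ↥W) (_ : W ≤ U) (N : ℕ)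
        (σ : Γ(↑(ρ ⁻¹ᵁ W), ⊤) →+* Γ(↑W, ⊤)),
        (∀ c, (ρ ∣_ W).appTop (σ c) = c ^ p ^ N) ∧ ∀ a, σ ((ρ ∣_ W).appTop a) = a ^ p ^ N := by
  sorry

/-- (T2) **The twisted relative Frobenius `Ψ : X → Spec L ×ₖ X` is finite, radicial and
surjective.** For `ψ : L → k` finite with `ψ(x) = x^{p^r}` (i.e. `k ⊆ L ⊆ k^{1/p^r}`),
`Ψ := (F_X^r, f ≫ Spec ψ)`; locally of finite type because `Spec ψ` is finite, integral and
radicial because `F_X^r` is (cf. `exists_relFrobenius`, the case `L` a full level). [folklore] -/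
theorem stub_relFrobeniusTwisted :
    ∀ (p : ℕ) [Fact p.Prime] (k : Type) [Field k] [CharP k p] (L : Type) [Field L] [Algebra k L]
      (r : ℕ) (ψ : L →+* k), (∀ x : L, algebraMap k L (ψ x) = x ^ p ^ r) →
      (∀ a : k, ψ (algebraMap k L a) = a ^ p ^ r) → ψ.Finite →
      ∀ (X : Scheme.{0}) (f : X ⟶ Spec (.of k)) [LocallyOfFiniteType f] (hX : (p : Γ(X, ⊤)) = 0),
      ∃ Ψ : X ⟶ pullback f (Spec.map (CommRingCat.ofHom (algebraMap k L))),
        IsFinite Ψ ∧ UniversallyInjective Ψ ∧ Surjective Ψ ∧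
        Ψ ≫ pullback.fst f (Spec.map (CommRingCat.ofHom (algebraMap k L))) =
          powEndo X (p ^ r) (pow_ne_zero r (Fact.out : p.Prime).ne_zero)
            (add_pow_prime_pow_sections X p hX r) ∧
        Ψ ≫ pullback.snd f (Spec.map (CommRingCat.ofHom (algebraMap k L))) =
          f ≫ Spec.map (CommRingCat.ofHom ψ) := by
  sorry

/-- (T3) **A `p`-basis adapted to finitely many constants, with its dual derivations.** For a
finite set `C` of a field `k` of characteristic `p` there are elements `u_i ∈ k` and derivations
`D_i` of `k` with `D_i(u_j) = δ_ij`, `D_i(c) = 0` for `c ∈ C`, and `k` finite over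
`k^{p^r}(u_i : i)` (take a `p`-basis `Γ`, a finite `B₀ ⊆ Γ` with `C ⊆ k^p(B₀)`, `u = Γ ∖ B₀`;
Matsumura §26, tree `PIndependence` / `PIndependentDerivations`). [cite: Matsumura1987, §26 p. 202] -/
theorem stub_pBasisDerivations :
    ∀ (p : ℕ) [Fact p.Prime] (k : Type) [Field k] [CharP k p] (C : Finset k) (r : ℕ),
      ∃ (G : Type) (u : G → k) (D : G → Derivation ℤ k k),
        (∀ i, D i (u i) = 1) ∧ (∀ i j, i ≠ j → D i (u j) = 0) ∧ (∀ i, ∀ c ∈ C, D i c = 0) ∧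
        Module.Finite (Subring.closure (Set.range (iterateFrobenius k p r) ∪ Set.range u)) k := by
  sorry

/-- (T3') **Derivations of the constants extend to finitely presented algebras whose relations
they kill**: a derivation `D` of `k` killing every coefficient of the generators `s` of an ideal of
`k[X_1, …, X_n]` induces a derivation of `k[X]/(s)` compatible with `D` on constants
(coefficientwise extension with `D(X_j) = 0` preserves `(s)`). [folklore] -/
theorem stub_derivationQuotientMvPolynomial :
    ∀ (k : Type) [CommRing k] (n : ℕ) (s : Finset (MvPolynomial (Fin n) k)) (D : Derivation ℤ k k),
      (∀ f ∈ s, ∀ m, D (MvPolynomial.coeff m f) = 0) →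
      ∃ D' : Derivation ℤ (MvPolynomial (Fin n) k ⧸ Ideal.span (s : Set (MvPolynomial (Fin n) k)))
          (MvPolynomial (Fin n) k ⧸ Ideal.span (s : Set (MvPolynomial (Fin n) k))),
        ∀ a : k, D' (algebraMap k _ a) = algebraMap k _ (D a) := by
  sorry

/-- (T4) **Adjoining finitely many good `p^r`-th roots to the constants keeps `A` regular.** For a
regular `k`-algebra `A` with derivations `D_i` and constants `u_i` with `D_i(u_j) = δ_ij`, and
`θ_i` with `θ_i^{p^r} = u_i` in an extension `E/k`: `k(θ_i : i ∈ S) ⊗ₖ A` is a regular ring for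
every finite `S` (induction on `S`: each step is `F(θ) ⊗ A ≅ (F ⊗ A)[z]/(z^{p^m} - a ⊗ 1)` with
`minpoly_F θ = z^{p^m} - a`; the derivation `D_i` on `F ⊗ A` forces `m = r`, `a = u_i` and makes
Stacks 07PG (`isRegularRing_tensor_of_minpoly_eq_X_pow_sub_C`) applicable; the other `D_j`
descend to the next stage because `D_j(u_i) = 0`). [cite: StacksProject, Tag 07PG] -/
theorem stub_regularTensorAdjoinRoots :
    ∀ (p : ℕ) [Fact p.Prime] (k : Type) [Field k] [CharP k p] (A : Type) [CommRing A] [Algebra k A]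
      [IsRegularRing A] (r : ℕ) (G : Type) (u : G → k) (D : G → Derivation ℤ A A),
      (∀ i, D i (algebraMap k A (u i)) = 1) → (∀ i j, i ≠ j → D i (algebraMap k A (u j)) = 0) →
      ∀ (E : Type) [Field E] [Algebra k E] (θ : G → E), (∀ i, θ i ^ p ^ r = algebraMap k E (u i)) →
      ∀ S : Finset G,
        IsRegularRing (↥(IntermediateField.adjoin k (θ '' (S : Set G))) ⊗[k] A) := by
  sorry

/-- (T5) **A Noetherian local ring exhausted by regular local subrings of the same dimension is
regular**: if `O` is Noetherian local and every finite subset of `O` lies in the image of some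
injective, local, integral homomorphism `O_i → O` from a regular local ring, then `O` is regular
(`dim O = dim O_i` by integrality; any `dim O + 1` elements of `𝔪_O` are dependent modulo `𝔪²`
already in some `O_i`, so `edim O ≤ dim O`). [folklore] -/
theorem stub_directedUnionRegular :
    ∀ (O : Type) [CommRing O] [IsLocalRing O] [IsNoetherianRing O] (ι : Type) (Oi : ι → Type)
      [∀ i, CommRing (Oi i)] [∀ i, IsLocalRing (Oi i)] (φ : ∀ i, Oi i →+* O),
      (∀ i, IsLocalHom (φ i)) → (∀ i, Function.Injective (φ i)) → (∀ i, (φ i).IsIntegral) →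
      (∀ i, IsRegularLocalRing (Oi i)) →
      (∀ s : Finset O, ∃ i, (s : Set O) ⊆ Set.range (φ i)) →
      IsRegularLocalRing O := by
  sorry

/-- (lead) **Glue for the cofinite regular twist** — from the p-basis data (T3), the extension of
its derivations to finitely presented charts (T3'), regularity of the finite root stages (T4) and
the directed-union lemma (T5) to: for `Z` regular of finite type over `k` and `r`, a field
`L ⊇ k` inside `k^{1/p^r}` with `ψ : L → k` (`x ↦ x^{p^r}`) FINITE and `Z ×ₖ Spec L` regular
(affine cover of `Z`, presentations, coefficient set `C`, `L := k(θ_i)` inside the perfect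
closure, `ψ` from the full level `θ_r`, regularity chartwise at every prime). [folklore] -/
theorem stub_cofiniteRegularTwistGlue :
    (∀ (p : ℕ) [Fact p.Prime] (k : Type) [Field k] [CharP k p] (C : Finset k) (r : ℕ),
      ∃ (G : Type) (u : G → k) (D : G → Derivation ℤ k k),
        (∀ i, D i (u i) = 1) ∧ (∀ i j, i ≠ j → D i (u j) = 0) ∧ (∀ i, ∀ c ∈ C, D i c = 0) ∧
        Module.Finite (Subring.closure (Set.range (iterateFrobenius k p r) ∪ Set.range u)) k) →
    (∀ (k : Type) [CommRing k] (n : ℕ) (s : Finset (MvPolynomial (Fin n) k)) (D : Derivation ℤ k k),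
      (∀ f ∈ s, ∀ m, D (MvPolynomial.coeff m f) = 0) →
      ∃ D' : Derivation ℤ (MvPolynomial (Fin n) k ⧸ Ideal.span (s : Set (MvPolynomial (Fin n) k)))
          (MvPolynomial (Fin n) k ⧸ Ideal.span (s : Set (MvPolynomial (Fin n) k))),
        ∀ a : k, D' (algebraMap k _ a) = algebraMap k _ (D a)) →
    (∀ (p : ℕ) [Fact p.Prime] (k : Type) [Field k] [CharP k p] (A : Type) [CommRing A] [Algebra k A]
      [IsRegularRing A] (r : ℕ) (G : Type) (u : G → k) (D : G → Derivation ℤ A A),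
      (∀ i, D i (algebraMap k A (u i)) = 1) → (∀ i j, i ≠ j → D i (algebraMap k A (u j)) = 0) →
      ∀ (E : Type) [Field E] [Algebra k E] (θ : G → E), (∀ i, θ i ^ p ^ r = algebraMap k E (u i)) →
      ∀ S : Finset G,
        IsRegularRing (↥(IntermediateField.adjoin k (θ '' (S : Set G))) ⊗[k] A)) →
    (∀ (O : Type) [CommRing O] [IsLocalRing O] [IsNoetherianRing O] (ι : Type) (Oi : ι → Type)
      [∀ i, CommRing (Oi i)] [∀ i, IsLocalRing (Oi i)] (φ : ∀ i, Oi i →+* O),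
      (∀ i, IsLocalHom (φ i)) → (∀ i, Function.Injective (φ i)) → (∀ i, (φ i).IsIntegral) →
      (∀ i, IsRegularLocalRing (Oi i)) →
      (∀ s : Finset O, ∃ i, (s : Set O) ⊆ Set.range (φ i)) →
      IsRegularLocalRing O) →
    ∀ (p : ℕ) [Fact p.Prime] (k : Type) [Field k] [CharP k p] (Z : Scheme.{0})
      (fZ : Z ⟶ Spec (.of k)) [LocallyOfFiniteType fZ] [QuasiCompact fZ], Scheme.IsRegular Z →
      ∀ r : ℕ, ∃ (L : Type) (_ : Field L) (_ : Algebra k L) (ψ : L →+* k),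
        (∀ x : L, algebraMap k L (ψ x) = x ^ p ^ r) ∧ (∀ a : k, ψ (algebraMap k L a) = a ^ p ^ r) ∧
        ψ.Finite ∧ Scheme.IsRegular (pullback fZ (Spec.map (CommRingCat.ofHom (algebraMap k L)))) := by
  sorry

/-- (T6 = planner's `stub_cofiniteRegularTwist`, hardest; lead) **The cofinite regular twist**:
for `Z` regular of finite type over a field `k` of characteristic `p` and `r ≥ 0` there is a field
`L ⊇ k` with `ψ : L → k`, `ψ(x) = x^{p^r}` (so `k ⊆ L ⊆ k^{1/p^r}`), `k` FINITE over `ψ(L)`, and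
`Z ×ₖ Spec L` regular (`L = k(good p^r-th roots)`, Θ_fin-sorted `p`-basis; Matsumura Thm. 30.5,
Stacks 07PG). [cite: Matsumura1987, Thm. 30.5] -/
theorem stub_cofiniteRegularTwist :
    ∀ (p : ℕ) [Fact p.Prime] (k : Type) [Field k] [CharP k p] (Z : Scheme.{0})
      (fZ : Z ⟶ Spec (.of k)) [LocallyOfFiniteType fZ] [QuasiCompact fZ], Scheme.IsRegular Z →
      ∀ r : ℕ, ∃ (L : Type) (_ : Field L) (_ : Algebra k L) (ψ : L →+* k),
        (∀ x : L, algebraMap k L (ψ x) = x ^ p ^ r) ∧ (∀ a : k, ψ (algebraMap k L a) = a ^ p ^ r) ∧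
        ψ.Finite ∧ Scheme.IsRegular (pullback fZ (Spec.map (CommRingCat.ofHom (algebraMap k L)))) :=
  stub_cofiniteRegularTwistGlue stub_pBasisDerivations stub_derivationQuotientMvPolynomial
    stub_regularTensorAdjoinRoots stub_directedUnionRegular

/-! ## Composition -/

section Composition

/-- A proper morphism whose restriction over a dense open is an isomorphism is surjective (its
image is closed and contains the dense open). [folklore] -/
theorem surjective_of_isBirational_of_universallyClosed {X' X : Scheme.{0}} (π : X' ⟶ X)
    [UniversallyClosed π] (h : IsBirational π) : Surjective π := by
  obtain ⟨U, hU, -, hiso⟩ := h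
  refine ⟨fun x => ?_⟩
  have hcl : IsClosed (Set.range π.base) := π.isClosedMap.isClosed_range
  have hsub : (U : Set X) ⊆ Set.range π.base := by
    intro u hu
    obtain ⟨y, hy⟩ := (inferInstance : Surjective (π ∣_ U)).1 ⟨u, hu⟩
    refine ⟨y.1, ?_⟩
    have := congrArg Subtype.val hy
    rwa [morphismRestrict_base_coe] at this
  have hx : x ∈ closure (U : Set X) := hU x
  exact (hcl.closure_subset_iff.mpr hsub) hx

/-- The pull-back of an irreducible scheme along a universal homeomorphism is irreducible
(`pullback.fst` version of `irreducibleSpace_pullback_of_universallyClosed`). [folklore] -/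
theorem irreducibleSpace_pullback_fst_of_universallyClosed {X Y T : Scheme.{0}} (ρ : Y ⟶ T)
    (h : X ⟶ T) [UniversallyClosed h] [UniversallyInjective h] [Surjective h] [IrreducibleSpace Y] :
    IrreducibleSpace ↑(pullback ρ h) :=
  haveI : UniversallyInjective (pullback.fst ρ h) :=
    MorphismProperty.pullback_fst (P := @UniversallyInjective) _ _ ‹_›
  (isHomeomorph_of_universallyClosed_of_universallyInjective
    (pullback.fst ρ h)).homeomorph.irreducibleSpace_iff.mpr ‹_›

end Composition

/-! ## The crux, by name -/

-- as in Mathlib's pullback API for schemes / `morphismRestrict_app`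
set_option backward.isDefEq.respectTransparency false in
set_option maxHeartbeats 800000 in
/-- **`PICover_p ⇒ RadicialBottom_p` for every prime `p` and EVERY ground field `k`** (crux
`PicoverToRadicialBottom`, line `theta-finite-cofinite-roots`). Let `g : X'' → X` be finite,
universally injective and surjective between integral schemes, `X` separated of finite type over
`k` (`char k = p`), `π : Z → X''` a resolution; put `ρ := π ≫ g`. Over the open
`U := X ∖ g(X'' ∖ V)` (`V` the iso-locus of `π`) `ρ` is finite and radicial, so over a non-empty
affine `W ≤ U` its `p^N`-Frobenius factors through `Γ(W)` (`stub_frobeniusFactorGeneric`). Let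
`L ⊇ k`, `ψ : L → k` finite with `ψ(x) = x^{p^N}` and `Z_L := Z ×ₖ Spec L` REGULAR
(`stub_cofiniteRegularTwist`), and `Ψ : X → X_L := Spec L ×ₖ X` the twisted relative Frobenius,
finite, radicial, surjective with `Ψ ≫ pr = F_X^N` (`stub_relFrobeniusTwisted`). With
`Y' := Z ×_X X_L ≅ Z_L` (regular, integral, separated of finite type over the field `L`) and
`ρ_L : Y' → X_L` the base change of `ρ`, the reduced pull-back `T := (X ×_{Ψ, X_L} Y')_red` is
integral and finite, radicial, surjective over `Y'`, so `PICover_p` over the field `L` resolves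
`T`; and `T → X` is proper and birational: over `W` it is injective and has the section
`w ↦ (w, (σ-point of w, Ψ w))`, hence is an isomorphism there. [folklore] -/
theorem PicoverToRadicialBottom_of : PicoverToRadicialBottom := by
  intro p hp hPC k _ _ X X'' f g hsep hlft hqc hXint hX''int hgfin hgui hgsurj hres
  haveI : Fact p.Prime := ⟨hp⟩
  haveI := hsep; haveI := hlft; haveI := hqc; haveI := hXint; haveI := hX''int
  haveI := hgfin; haveI := hgui
  haveI : Surjective g := ⟨hgsurj⟩
  obtain ⟨Z, π, hπ⟩ := hres
  haveI := hπ.isProper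
  have hZreg : Scheme.IsRegular Z := hπ.isRegular
  -- `Z` is integral
  haveI : IrreducibleSpace Z := hπ.isBirational.irreducibleSpace
  haveI : IsReduced Z := hZreg.isReduced
  haveI : IsIntegral Z := isIntegral_of_irreducibleSpace_of_isReduced Z
  haveI : Surjective π := surjective_of_isBirational_of_universallyClosed π hπ.isBirational
  obtain ⟨V, hVd, -, hVi⟩ := hπ.isBirational
  -- Step 1: the open `U = X ∖ g(X'' ∖ V)` over which `ρ = π ≫ g` is finite and radicial
  have hgcl : IsClosed (g.base '' (V : Set X'')ᶜ) := g.isClosedMap _ V.2.isClosed_compl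
  let U : X.Opens := ⟨(g.base '' (V : Set X'')ᶜ)ᶜ, hgcl.isOpen_compl⟩
  have hgU : g ⁻¹ᵁ U ≤ V := by
    intro x hx
    by_contra hxV
    exact hx ⟨x, hxV, rfl⟩
  obtain ⟨v, hv⟩ := hVd.nonempty
  have hvU : g.base v ∈ U := by
    rintro ⟨x, hx, hxe⟩
    exact hx (by rwa [g.injective hxe])
  haveI : Nonempty ↥U := ⟨⟨g.base v, hvU⟩⟩
  haveI : IsIso (π ∣_ g ⁻¹ᵁ U) := isIso_morphismRestrict_of_le π hVi hgU
  haveI : IsFinite (g ∣_ U) := IsZariskiLocalAtTarget.restrict hgfin U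
  haveI : UniversallyInjective (g ∣_ U) := IsZariskiLocalAtTarget.restrict hgui U
  haveI hρUfin : IsFinite ((π ≫ g) ∣_ U) := by
    rw [morphismRestrict_comp]; infer_instance
  haveI hρUui : UniversallyInjective ((π ≫ g) ∣_ U) := by
    rw [morphismRestrict_comp]
    exact MorphismProperty.comp_mem @UniversallyInjective _ _ inferInstance inferInstance
  -- characteristic
  have hpX : (p : Γ(X, ⊤)) = 0 := natCast_appTop_eq_zero p f
  -- Step 2: the Frobenius factor over an affine `W ≤ U`
  obtain ⟨W, hW, hWne, hWU, N, σ, hσ1, hσ2⟩ := stub_frobeniusFactorGeneric p Z X (π ≫ g) U hpX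
  obtain ⟨⟨u, huW⟩⟩ := hWne
  haveI : Nonempty ↥W := ⟨⟨u, huW⟩⟩
  haveI : Nonempty ↑(W : Scheme.{0}) := ⟨⟨u, huW⟩⟩
  haveI : IsAffine W := hW
  haveI hρWfin : IsFinite ((π ≫ g) ∣_ W) := restrict_of_le (π ≫ g) hWU hρUfin
  haveI hρWui : UniversallyInjective ((π ≫ g) ∣_ W) := restrict_of_le (π ≫ g) hWU hρUui
  haveI : IsIntegral (W : Scheme.{0}) := isIntegral_of_isOpenImmersion W.ι
  -- Step 3: the cofinite regular twist of `Z`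
  obtain ⟨L, instL, instA, ψ, hψ1, hψ2, hψfin, hYreg⟩ :=
    stub_cofiniteRegularTwist p k Z ((π ≫ g) ≫ f) hZreg N
  letI := instL
  letI := instA
  haveI : CharP L p := charP_of_injective_algebraMap (algebraMap k L).injective p
  have hrad : ∀ x : L, ∃ (n : ℕ) (y : k), algebraMap k L y = x ^ p ^ n := fun x => ⟨N, ψ x, hψ1 x⟩
  set iL : Spec (.of L) ⟶ Spec (.of k) := Spec.map (CommRingCat.ofHom (algebraMap k L)) with hiL
  haveI : UniversallyInjective iL := universallyInjective_specMap_field_of_pow_mem _ p hrad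
  haveI : Surjective iL := surjective_specMap_field _
  haveI : IsIntegralHom iL := isIntegralHom_specMap_of_pow_mem _ p hrad
  -- Step 4: the twisted relative Frobenius `Ψ : X → X_L`
  set F := powEndo X (p ^ N) (pow_ne_zero N (Fact.out : p.Prime).ne_zero)
    (add_pow_prime_pow_sections X p hpX N) with hFdef
  obtain ⟨Ψ, hΨfin, hΨui, hΨsurj, hΨfst, -⟩ :=
    stub_relFrobeniusTwisted p k L N ψ hψ1 hψ2 hψfin X f hpX
  haveI := hΨfin; haveI := hΨui; haveI := hΨsurj
  set h' := pullback.fst f iL with hh'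
  haveI : UniversallyInjective h' := MorphismProperty.pullback_fst (P := @UniversallyInjective) _ _ ‹_›
  -- Step 5: `Y' = Z ×_X X_L ≅ Z_L`, regular and integral; `ρ_L : Y' → X_L` proper
  set Y' := pullback (π ≫ g) h' with hY'
  set ρL := pullback.snd (π ≫ g) h' with hρL
  have hY'reg : Scheme.IsRegular Y' :=
    Scheme.IsRegular.of_iso (pullbackRightPullbackFstIso f iL (π ≫ g)).inv hYreg
  haveI : IrreducibleSpace ↥Y' := irreducibleSpace_pullback_fst_of_universallyClosed (π ≫ g) h'
  haveI : IsReduced Y' := hY'reg.isReduced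
  haveI hY'int : IsIntegral Y' := isIntegral_of_irreducibleSpace_of_isReduced Y'
  -- Step 6: the reduced pull-back `T` and its resolution from `PICover_p` over `L`
  set T := (vanishingIdeal (⊤ : Closeds ↑(pullback Ψ ρL))).subscheme with hTdef
  set ι := (vanishingIdeal (⊤ : Closeds ↑(pullback Ψ ρL))).subschemeι with hιdef
  haveI hTint : IsIntegral T := isIntegral_reduced_pullback Ψ ρL
  have hTres : Scheme.HasResolution T :=
    hPC L Y' T (ρL ≫ pullback.snd f iL) (ι ≫ pullback.snd Ψ ρL) inferInstance inferInstance
      inferInstance hY'int hY'reg hTint (isFinite_reduced_pullback_snd Ψ ρL)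
      (universallyInjective_reduced_pullback_snd Ψ ρL) (surjective_reduced_pullback_snd Ψ ρL).1
  -- Step 7: `πT : T → X` is proper and birational
  set πT := ι ≫ pullback.fst Ψ ρL with hπTdef
  haveI : IsProper πT := inferInstance
  refine Scheme.HasResolution.of_isBirational πT ⟨W, W.2.dense ⟨u, huW⟩, ?_, ?_⟩ hTres
  · refine (πT ⁻¹ᵁ W).2.dense ?_
    obtain ⟨z, hz⟩ := (inferInstance : Surjective πT).1 u
    exact ⟨z, show πT.base z ∈ W by rw [hz]; exact huW⟩
  -- points of `T` over `W`: their images in `Z`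
  have himg : ∀ c : ↥(πT ⁻¹ᵁ W),
      (π ≫ g).base ((pullback.fst (π ≫ g) h').base ((pullback.snd Ψ ρL).base (ι.base c.1))) =
        πT.base c.1 := by
    intro c
    rw [← Scheme.Hom.comp_apply _ (π ≫ g), pullback.condition, Scheme.Hom.comp_apply,
      ← Scheme.Hom.comp_apply _ ρL, ← pullback.condition, Scheme.Hom.comp_apply,
      ← Scheme.Hom.comp_apply _ h', hΨfst]
    rfl
  have hinj : Function.Injective (πT ∣_ W).base := by
    intro a b hab
    have h1 : πT.base a.1 = πT.base b.1 := by
      have := congrArg Subtype.val hab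
      rwa [morphismRestrict_base_coe, morphismRestrict_base_coe] at this
    have hz : (pullback.fst (π ≫ g) h').base ((pullback.snd Ψ ρL).base (ι.base a.1)) =
        (pullback.fst (π ≫ g) h').base ((pullback.snd Ψ ρL).base (ι.base b.1)) := by
      have hmem : ∀ c : ↥(πT ⁻¹ᵁ W),
          (pullback.fst (π ≫ g) h').base ((pullback.snd Ψ ρL).base (ι.base c.1)) ∈
            (π ≫ g) ⁻¹ᵁ W := fun c =>
        show (π ≫ g).base _ ∈ W by rw [himg c]; exact c.2
      have key : ((π ≫ g) ∣_ W).base ⟨_, hmem a⟩ = ((π ≫ g) ∣_ W).base ⟨_, hmem b⟩ := by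
        apply Subtype.ext
        rw [morphismRestrict_base_coe, morphismRestrict_base_coe, himg, himg]
        exact h1
      exact congrArg Subtype.val (((π ≫ g) ∣_ W).injective key)
    haveI : UniversallyInjective (pullback.fst (π ≫ g) h') :=
      MorphismProperty.pullback_fst (P := @UniversallyInjective) _ _ ‹_›
    have hy := (pullback.fst (π ≫ g) h').injective hz
    exact Subtype.ext (ι.isClosedEmbedding.injective ((pullback.snd Ψ ρL).injective hy))
  -- the section over `W`: first `b₀ : W → ρ⁻¹ W`, `Spec` of the Frobenius factor `σ`
  have hpW : (p : Γ((W : Scheme.{0}), ⊤)) = 0 := by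
    rw [← map_natCast W.ι.appTop.hom p, hpX, map_zero]
  haveI : IsAffine ((π ≫ g) ⁻¹ᵁ W : Scheme.{0}) := isAffine_of_isAffineHom ((π ≫ g) ∣_ W)
  have haddW := add_pow_sections p hpW N
  have hpS : (p : Γ(Spec Γ((W : Scheme.{0}), ⊤), ⊤)) = 0 :=
    natCast_appTop_eq_zero p ((W : Scheme.{0}).isoSpec.inv ≫ W.ι ≫ f)
  have haddS := add_pow_sections p hpS N
  let τ : Γ(((π ≫ g) ⁻¹ᵁ W : Scheme.{0}), ⊤) ⟶ Γ((W : Scheme.{0}), ⊤) := CommRingCat.ofHom σ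
  have e1 : ((π ≫ g) ∣_ W).appTop ≫ τ = CommRingCat.ofHom (powRingHom Γ((W : Scheme.{0}), ⊤)
      (p ^ N) (pow_ne_zero N hp.ne_zero) (haddW ⊤)) := by
    ext a
    simp only [τ, CommRingCat.hom_comp, CommRingCat.hom_ofHom, RingHom.comp_apply, powRingHom_apply]
    exact hσ2 a
  let b₀ : (W : Scheme.{0}) ⟶ ((π ≫ g) ⁻¹ᵁ W : Scheme.{0}) :=
    (W : Scheme.{0}).isoSpec.hom ≫ Spec.map τ ≫ ((π ≫ g) ⁻¹ᵁ W : Scheme.{0}).isoSpec.inv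
  have hb₀ : b₀ ≫ ((π ≫ g) ∣_ W) =
      powEndo (W : Scheme.{0}) (p ^ N) (pow_ne_zero N hp.ne_zero) haddW := by
    have h1 : ((π ≫ g) ⁻¹ᵁ W : Scheme.{0}).isoSpec.inv ≫ ((π ≫ g) ∣_ W) =
        Spec.map ((π ≫ g) ∣_ W).appTop ≫ (W : Scheme.{0}).isoSpec.inv :=
      (Scheme.isoSpec_inv_naturality _).symm
    have h3 : Spec.map (CommRingCat.ofHom (powRingHom Γ((W : Scheme.{0}), ⊤) (p ^ N)
        (pow_ne_zero N hp.ne_zero) (haddW ⊤))) =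
        powEndo (Spec Γ((W : Scheme.{0}), ⊤)) (p ^ N) (pow_ne_zero N hp.ne_zero) haddS :=
      (powEndo_Spec (p ^ N) (pow_ne_zero N hp.ne_zero) (Γ((W : Scheme.{0}), ⊤)) (haddW ⊤) haddS).symm
    have h2 : Spec.map τ ≫ Spec.map ((π ≫ g) ∣_ W).appTop =
        powEndo (Spec Γ((W : Scheme.{0}), ⊤)) (p ^ N) (pow_ne_zero N hp.ne_zero) haddS := by
      rw [← Spec.map_comp, e1, h3]
    have h4 : (W : Scheme.{0}).isoSpec.hom ≫
        powEndo (Spec Γ((W : Scheme.{0}), ⊤)) (p ^ N) (pow_ne_zero N hp.ne_zero) haddS =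
        powEndo (W : Scheme.{0}) (p ^ N) (pow_ne_zero N hp.ne_zero) haddW ≫
          (W : Scheme.{0}).isoSpec.hom :=
      (powEndo_comp (p ^ N) (pow_ne_zero N hp.ne_zero) haddW _ haddS).symm
    simp only [b₀, Category.assoc]
    rw [h1, ← Category.assoc (Spec.map τ), h2, ← Category.assoc, h4, Category.assoc, Iso.hom_inv_id,
      Category.comp_id]
  -- the point of `Y'` over `W`, then of the pull-back, then of `T`
  have hw : (b₀ ≫ ((π ≫ g) ⁻¹ᵁ W).ι) ≫ (π ≫ g) = (W.ι ≫ Ψ) ≫ h' := by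
    rw [Category.assoc, ← morphismRestrict_ι, ← Category.assoc, hb₀, Category.assoc, hΨfst]
    exact powEndo_comp (p ^ N) (pow_ne_zero N hp.ne_zero) haddW W.ι
      (add_pow_prime_pow_sections X p hpX N)
  let yW : (W : Scheme.{0}) ⟶ Y' := pullback.lift (b₀ ≫ ((π ≫ g) ⁻¹ᵁ W).ι) (W.ι ≫ Ψ) hw
  have hyW : W.ι ≫ Ψ = yW ≫ ρL := by rw [hρL, pullback.lift_snd]
  obtain ⟨s₁, hs₁⟩ := exists_lift_reduced (pullback.lift W.ι yW hyW)
  have hs₁π : s₁ ≫ πT = W.ι := by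
    rw [hπTdef, ← Category.assoc, hιdef, hs₁, pullback.lift_fst]
  have hrange : Set.range s₁.base ⊆ Set.range (πT ⁻¹ᵁ W).ι.base := by
    rintro _ ⟨w, rfl⟩
    rw [Scheme.Opens.range_ι]
    show πT.base (s₁.base w) ∈ W
    rw [← Scheme.Hom.comp_apply, hs₁π]
    exact w.2
  have hs : IsOpenImmersion.lift (πT ⁻¹ᵁ W).ι s₁ hrange ≫ (πT ∣_ W) = 𝟙 _ := by
    rw [← cancel_mono W.ι, Category.assoc, morphismRestrict_ι, ← Category.assoc,
      IsOpenImmersion.lift_fac, hs₁π, Category.id_comp]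
  exact isIso_of_comp_eq_id_of_injective (πT ∣_ W) hinj _ hs

end Summit.ResolutionOfSingularities.ResolutionOfSingularities.Theorems

end
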